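import Mathlib
import HarnessLib
import Summits.HubbardSuperconductivity.HubbardSuperconductivity.Theorems.KLProgrammeKLRegimeEngineTowerWtRemeasureBase
import Summits.HubbardSuperconductivity.HubbardSuperconductivity.Theorems.KLProgrammeKLRegimeEngineTowerWtLawBaseTokX

/-!
# Route `KLProgramme` — crux K3 ENGINE (stmt-HubbardSuperconductivity-20437 `KLRegimeEngineV17F2`), stub (b) v2, THE WEIGHTED HALF «(b)-WT4»:
# W6 — THE WEIGHTED READ-OUT, RE-MEASURED PART (RO-1ʷ): the block input `𝒱_{dK_b}` read at the PUBLIC family `(F_j, rate j)`, `dK_b ≤ j ≤ n`, from the base datum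
# and the weighted law on the blocks `2 … K_b`
# (cell gate-hubbard-kl, seat hubbard-kl-k3c3-p2 g17; weighted twin of this lineage's RO-1 `readoutLevF_le_profileR(_anyJump)` (g16), on p4 g17's m-uniform weighted
#  jump row with the fine family `F_j`; E1 may rename or supersede)

At a read-out level `j` with `K_b := j/d` complete blocks (`d·K_b ≤ j`), the registered weighted size is `klWtPinnedSum … (K_n) j (2p) q w =
klWtPinnedSumAt … j j (2p) (𝒱_j) q w` and `𝒱_j = 𝒱_{dK_b} + (𝒱_j − 𝒱_{dK_b})`.  This file bounds the first summand: `𝒱_{dK_b} = 𝒱_d + Σ_{1≤k′<K_b} Δ_{k′}` is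
re-measured at `F_j` from the base family `F_{d−1}` (jump `j−d+1 ≥ 1`) and from the born families `F_{dk′}` (jump `j − dk′ ≥ d(K_b−k′) ≥ d`) by the SAME
window-free m-uniform jump row as W3a (`klWtPinnedSumAt_jump_le_klEng_flow_all_uniform`, p4 g17), and in the track-`0` floor units of the public family the
jump factor is again the pure gain `((2^{p−3})⁻¹)^{jump} ≤ 1` (`p ≥ 3`):
* §1 `jumpW_mul_div_klLevUnitF_eq` — `(2^{J′−J})^{2p−2}·X / klLevUnitF β M 0 p J′ = ((2^{p−3})⁻¹)^{J′−J}·(X / klLevUnitF β M 0 p J)` (`J ≤ J′`, `3 ≤ p`), and the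
  two monotone consequences (`≤ X/unitF(J)`; `≤ ρ^{n}·X/unitF(J)` when `J′ − J ≥ d·n`, `ρ = (2^d)⁻¹`, `p ≥ 4`);
* §2 **`klWtPinnedSumAt_klTowerInput_readout_le_klEng_uniform (R c″)`** — on `K_n`, `2 ≤ d`, `1 ≤ K_b`, `d·K_b ≤ j ≤ n`, degree `m+1`, per pin:
  `klWtPinnedSumAt … j j (m+1) (𝒱_{dK_b}) q w ≤ C₁C₂^m·(2^{j−(d−1)})^{m−1}·N_b + Σ_{1≤k′<K_b} C₁C₂^m·(2^{j−dk′})^{m−1}·klTowerBornWtAt … d k′ j (m+1)`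
  (`N_b` = any bound of the rate-`j` weighted pinned sums of `𝒱_d` at `F_{d−1}` in degree `m+1`, i.e. the law's base datum row);
* §3 **`readoutWt_ro_le_profile_klEng (R c″)`** — in floor units, for `4 ≤ p ≤ D`, from the base unit law `(A_b, Q_b)` and the law `Aλ^{p−1}Q′^p` on the born
  arrays of the blocks `2 ≤ k ≤ K_b`: `klWtPinnedSumAt … j j (2p) (𝒱_{dK_b}) q w / klLevUnitF β M 0 p j ≤ A_ro·λ^{p−1}·Q_ro^p` with
  **`A_ro = (C₁/C₂)·(A_b + A)`, `Q_ro = C₂²·max Q′ Q_b`** (geometric sum with ratio `(2^d)⁻¹ ≤ 1/2`).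
Everything is proved; no definitions; nothing about the model is asserted; nothing asserts (b), (ℓ), any stub, K3 or superconductivity.
References: BGM 2006 §2.8 (2.76), (2.82)–(2.84), (2.93)–(2.98) [cite: BenfattoGiulianiMastropietro2006].
-/

noncomputable section

namespace Summit.HubbardSuperconductivity.HubbardSuperconductivity.Theorems.EngineV8

set_option linter.dupNamespace false -- summit = problem name (single-conjunct summit), D-0017

open Classical
open Real Finset Literature.MathematicalPhysics.QuantumLattice Literature.Probability.LatticeModels GrassmannAlgebra
open Literature.MathematicalPhysics.QuantumLattice.FermiRG
open Summit.HubbardSuperconductivity.HubbardSuperconductivity.Theorems.KLProgrammeLegKernels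
open Summit.HubbardSuperconductivity.HubbardSuperconductivity.Theorems.KLRegimeSplit
open Summit.HubbardSuperconductivity.HubbardSuperconductivity.Theorems.DispersionFlow
open Summit.HubbardSuperconductivity.HubbardSuperconductivity.Theorems.KLRegimeWick

variable {L M : ℕ} [NeZero L] [NeZero M]

/-! ## §1 The jump factor against the floor unit of the public family -/

omit [NeZero L] in
/-- **The weighted jump factor in the floor units of the finer family is a pure gain**: for `J ≤ J′` and `3 ≤ p`,
`(2^{J′−J})^{2p−2}·X / klLevUnitF β M 0 p J′ = ((2^{p−3})⁻¹)^{J′−J}·(X / klLevUnitF β M 0 p J)`. -/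
theorem jumpW_mul_div_klLevUnitF_eq {β : ℝ} (hβ : 0 < β) {J J' p : ℕ} (hJ : J ≤ J') (h3 : 3 ≤ p) (X : ℝ) :
    ((2 : ℝ) ^ (J' - J)) ^ (2 * p - 2) * X / klLevUnitF β M 0 p J' = (((2 : ℝ) ^ (p - 3))⁻¹) ^ (J' - J) * (X / klLevUnitF β M 0 p J) := by
  have hu0 : 0 < klLevUnitF β M 0 p J := klLevUnitF_pos hβ 0 p _
  have hr0 : 0 < klLevRatioF 0 p := klLevRatioF_pos 0 p
  obtain ⟨Δ, rfl⟩ : ∃ Δ, J' = J + Δ := ⟨J' - J, by omega⟩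
  rw [Nat.add_sub_cancel_left, klLevUnitF_add, ← pow_mul, mul_comm Δ, pow_mul, ← jumpW_div_klLevRatioF_eq h3, div_pow]
  field_simp

omit [NeZero L] in
/-- The jump of a nonnegative size never costs in floor units (`J ≤ J′`, `3 ≤ p`): `(2^{J′−J})^{2p−2}·X / unitF(p, J′) ≤ X / unitF(p, J)`. -/
theorem jumpW_mul_div_klLevUnitF_le {β : ℝ} (hβ : 0 < β) {J J' p : ℕ} (hJ : J ≤ J') (h3 : 3 ≤ p) {X : ℝ} (hX : 0 ≤ X) :
    ((2 : ℝ) ^ (J' - J)) ^ (2 * p - 2) * X / klLevUnitF β M 0 p J' ≤ X / klLevUnitF β M 0 p J := by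
  rw [jumpW_mul_div_klLevUnitF_eq hβ hJ h3 X]
  have hq : 0 ≤ X / klLevUnitF β M 0 p J := div_nonneg hX (klLevUnitF_pos hβ 0 p J).le
  exact mul_le_of_le_one_left hq (pow_le_one₀ (by positivity) (inv_le_one_of_one_le₀ (one_le_pow₀ (by norm_num))))

omit [NeZero L] in
/-- **A jump of at least `d·n` family steps gains `ρ^n`, `ρ = (2^d)⁻¹`** (`p ≥ 4`, `X ≥ 0`):
`(2^{J′−J})^{2p−2}·X / unitF(p, J′) ≤ ((2^d)⁻¹)^n·(X / unitF(p, J))` whenever `J + d·n ≤ J′`. -/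
theorem jumpW_mul_div_klLevUnitF_le_rate {β : ℝ} (hβ : 0 < β) {J J' p d n : ℕ} (hJ : J + d * n ≤ J') (h4 : 4 ≤ p) {X : ℝ} (hX : 0 ≤ X) :
    ((2 : ℝ) ^ (J' - J)) ^ (2 * p - 2) * X / klLevUnitF β M 0 p J' ≤ (((2 : ℝ) ^ d)⁻¹) ^ n * (X / klLevUnitF β M 0 p J) := by
  rw [jumpW_mul_div_klLevUnitF_eq hβ (by omega) (by omega) X]
  have hq : 0 ≤ X / klLevUnitF β M 0 p J := div_nonneg hX (klLevUnitF_pos hβ 0 p J).le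
  refine mul_le_mul_of_nonneg_right ?_ hq
  -- `((2^{p−3})⁻¹)^{J′−J} ≤ (2⁻¹)^{J′−J} ≤ (2⁻¹)^{d·n} = ((2^d)⁻¹)^n`
  have h1 : ((2 : ℝ) ^ (p - 3))⁻¹ ≤ (2 : ℝ)⁻¹ := by
    refine inv_anti₀ (by norm_num) ?_
    calc (2 : ℝ) = 2 ^ 1 := (pow_one _).symm
      _ ≤ 2 ^ (p - 3) := pow_le_pow_right₀ (by norm_num) (by omega)
  calc (((2 : ℝ) ^ (p - 3))⁻¹) ^ (J' - J) ≤ ((2 : ℝ)⁻¹) ^ (J' - J) := pow_le_pow_left₀ (by positivity) h1 _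
    _ ≤ ((2 : ℝ)⁻¹) ^ (d * n) := pow_le_pow_of_le_one (by positivity) (by norm_num) (by omega)
    _ = (((2 : ℝ) ^ d)⁻¹) ^ n := by rw [← inv_pow, pow_mul]

/-! ## §2 The block input re-measured at the public family, m-uniform row on the flow frame -/

omit [NeZero L] [NeZero M] in
/-- **THE BLOCK INPUT `𝒱_{dK_b}` RE-MEASURED AT `(F_j, rate j)`, `d·K_b ≤ j ≤ n`, ON THE FLOW FRAME, m-UNIFORM** (read-out twin of
`klTowerMeasWtAt_le_base_add_sum_bornWtAt_klEng_uniform`: fine family `F_j` instead of `F_{dk−1}`): per pin,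
`klWtPinnedSumAt … j j (m+1) (𝒱_{dK_b}) q w ≤ C₁C₂^m·(2^{j−(d−1)})^{m−1}·N_b + Σ_{1≤k′<K_b} C₁C₂^m·(2^{j−dk′})^{m−1}·klTowerBornWtAt … d k′ j (m+1)`.
[cite: BenfattoGiulianiMastropietro2006, §2.8 (2.76), (2.82)-(2.84), (2.88)-(2.90)] -/
theorem klWtPinnedSumAt_klTowerInput_readout_le_klEng_uniform (R : RenConsts) (c'' : ℝ) (hc'' : 0 ≤ c'') :
    ∃ C₁ C₂ : ℝ, 0 < C₁ ∧ 0 < C₂ ∧ (R.WF2 → ∃ c₃' : ℝ, 0 < c₃' ∧ ∃ U₀' : ℝ, 0 < U₀' ∧ ∀ m : ℕ,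
      ∀ (G : GeoConsts) (P : SplitConsts) (Q : EngConsts) (cc : ℝ), 0 < cc → cc ≤ klEngC₃6 P R → cc ≤ c₃' →
      ∀ μ ∈ klWindowC, ∀ U : ℝ, 0 < U → U ≤ min (klEngU₀3 P R cc) (1 / (R.Gfr 3 + 1)) → U ≤ U₀' → c'' * U ≤ 1 →
      ∀ β : ℝ, klBetaMin ≤ β → β ≤ Real.exp (cc / U ^ 2) →
      ∀ (L M : ℕ) [NeZero L] [NeZero M], klEngL₃ β U ≤ L → klEngM₃ β U L ≤ M →
      ∀ n : ℕ, 1 ≤ n → n ≤ nScales β + 1 → IsKLRegime U cc (-(n : ℤ)) → HistP klPredsV17F2 L M G P Q R β U μ 0 n →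
        (∀ m', 1 ≤ m' → m' < n → FlowPieceOscAt L M c'' β U μ m') →
      ∀ d Kb j : ℕ, 2 ≤ d → 1 ≤ Kb → d * Kb ≤ j → j ≤ n → ∀ Nb : ℝ, 0 ≤ Nb →
        (∀ (q : Fin (m + 1)) (w' : SpaceTimeIdx L M × SectorLeg (sectorCount (d - 1))),
          klWtPinnedSumAt L M β μ (klFlowFrameU L M β U μ n) (d - 1) j (m + 1) (klTowerInput L M β U μ (klFlowFrameU L M β U μ n) d 1) q w' ≤ Nb) →
        ∀ (q : Fin (m + 1)) (w : SpaceTimeIdx L M × SectorLeg (sectorCount j)),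
        klWtPinnedSumAt L M β μ (klFlowFrameU L M β U μ n) j j (m + 1) (klTowerInput L M β U μ (klFlowFrameU L M β U μ n) d Kb) q w ≤
          C₁ * C₂ ^ m * ((2 : ℝ) ^ (j - (d - 1))) ^ (m - 1) * Nb +
            ∑ k' ∈ Ico 1 Kb, C₁ * C₂ ^ m * ((2 : ℝ) ^ (j - d * k')) ^ (m - 1) *
              klTowerBornWtAt L M β U μ (klFlowFrameU L M β U μ n) d k' j (m + 1)) := by
  obtain ⟨C₁, C₂, hC₁, hC₂, h⟩ := klWtPinnedSumAt_jump_le_klEng_flow_all_uniform R c'' hc''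
  refine ⟨C₁, C₂, hC₁, hC₂, fun hR2 => ?_⟩
  obtain ⟨c₃, hc₃, U₀, hU₀, h'⟩ := h hR2
  refine ⟨c₃, hc₃, U₀, hU₀, ?_⟩
  intro m G P Q cc hcc hcc6 hcc₃' μ hμ U hU hUle hU₀' hcU β hβmin hβc L M _ _ hL3 hM3 n hn1 hnN hkl hhist hosc d Kb j hd hKb1 hKbj hjn Nb hNb0 hNb q w
  have hβ : 0 < β := KLRegimeSplit.pos_of_klBetaMin_le hβmin
  set K : TrigPolyC4v := klFlowFrameU L M β U μ n with hK
  have hdj : d ≤ j := le_trans (Nat.le_mul_of_pos_right d hKb1) hKbj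
  -- subadditivity along `𝒱_{dK_b} = 𝒱_d + Σ_{1≤k′<K_b} Δ_{k′}` at the public family
  rw [klTowerInput_eq_one_add_sum β U μ K d hKb1]
  refine (klWtPinnedSumAt_add_le hβ.le μ K _ j _ _ _ q w).trans (add_le_add ?_ ?_)
  · -- the base `𝒱_d`, coarse family `F_{d−1}`
    exact h' m G P Q cc hcc hcc6 hcc₃' μ hμ U hU hUle hU₀' hcU β hβmin hβc L M hL3 hM3 n hn1 hnN hkl hhist hosc (d - 1) j (by omega) hjn
      (klTowerInput L M β U μ K d 1) (fun m' X hX => klEffectiveAction_momentumConserving β U μ K klE0 _ m' X hX) j le_rfl q w Nb hNb0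
      (fun w' => hNb q w')
  · refine (klWtPinnedSumAt_sum_le hβ.le μ K _ j _ _ _ q w).trans (sum_le_sum fun k' hk' => ?_)
    obtain ⟨hk'1, hk'k⟩ := mem_Ico.1 hk'
    have hjk' : d * k' + 1 ≤ j := by
      have : d * k' + d ≤ d * Kb := by rw [← Nat.mul_succ]; exact Nat.mul_le_mul_left d hk'k
      omega
    exact h' m G P Q cc hcc hcc6 hcc₃' μ hμ U hU hUle hU₀' hcU β hβmin hβc L M hL3 hM3 n hn1 hnN hkl hhist hosc (d * k') j hjk' hjn
      (klTowerIncr L M β U μ K d k') (fun m' X hX => klTowerIncr_momentumConserving β U μ K d k' m' X hX) j le_rfl q w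
      (klTowerBornWtAt L M β U μ K d k' j (m + 1)) (klTowerBornWtAt_nonneg hβ.le U μ K d k' j (m + 1))
      (fun w' => klWtPinnedSumAt_le_klTowerBornWtAt β U μ K d k' j (m + 1) q w')

/-! ## §3 The re-measured part of the read-out under one law -/

omit [NeZero L] [NeZero M] in
/-- **THE RE-MEASURED BLOCK INPUT AT THE PUBLIC FAMILY UNDER ONE LAW** (RO-1ʷ): on `K_n`, for `2 ≤ d`, `1 ≤ K_b`, `d·K_b ≤ j ≤ n`, a cap `D`, nonnegative
`A, λ, Q′, A_b, Q_b`, base bounds `N_b p` (rate-`j` weighted pinned sums of `𝒱_d` at `F_{d−1}`) with the unit law `N_b p / klLevUnitF β M 0 p (d−1) ≤ A_bλ^{p−1}Q_b^p`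
(`3 ≤ p`) and the law on the born arrays of the blocks `2 ≤ k ≤ K_b` at rate `j`: for every `4 ≤ p ≤ D` and every pin,
`klWtPinnedSumAt … j j (2p) (𝒱_{dK_b}) q w / klLevUnitF β M 0 p j ≤ (C₁/C₂)·(A_b + A)·λ^{p−1}·(C₂²·max Q′ Q_b)^p`.
[cite: BenfattoGiulianiMastropietro2006, §2.8 (2.83), (2.93)-(2.98)] -/
theorem readoutWt_ro_le_profile_klEng (R : RenConsts) (c'' : ℝ) (hc'' : 0 ≤ c'') :
    ∃ C₁ C₂ : ℝ, 0 < C₁ ∧ 0 < C₂ ∧ (R.WF2 → ∃ c₃' : ℝ, 0 < c₃' ∧ ∃ U₀' : ℝ, 0 < U₀' ∧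
      ∀ (G : GeoConsts) (P : SplitConsts) (Q : EngConsts) (cc : ℝ), 0 < cc → cc ≤ klEngC₃6 P R → cc ≤ c₃' →
      ∀ μ ∈ klWindowC, ∀ U : ℝ, 0 < U → U ≤ min (klEngU₀3 P R cc) (1 / (R.Gfr 3 + 1)) → U ≤ U₀' → c'' * U ≤ 1 →
      ∀ β : ℝ, klBetaMin ≤ β → β ≤ Real.exp (cc / U ^ 2) →
      ∀ (L M : ℕ) [NeZero L] [NeZero M], klEngL₃ β U ≤ L → klEngM₃ β U L ≤ M →
      ∀ n : ℕ, 1 ≤ n → n ≤ nScales β + 1 → IsKLRegime U cc (-(n : ℤ)) → HistP klPredsV17F2 L M G P Q R β U μ 0 n →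
        (∀ m', 1 ≤ m' → m' < n → FlowPieceOscAt L M c'' β U μ m') →
      ∀ d Kb j : ℕ, 2 ≤ d → 1 ≤ Kb → d * Kb ≤ j → j ≤ n → ∀ D : ℕ,
      ∀ (A lam Q' Ab Qb : ℝ), 0 ≤ A → 0 ≤ lam → 0 ≤ Q' → 0 ≤ Ab → 0 ≤ Qb →
      ∀ Nb : ℕ → ℝ, (∀ p, 0 ≤ Nb p) →
        (∀ (p : ℕ) (q : Fin (2 * p)) (w' : SpaceTimeIdx L M × SectorLeg (sectorCount (d - 1))),
          klWtPinnedSumAt L M β μ (klFlowFrameU L M β U μ n) (d - 1) j (2 * p) (klTowerInput L M β U μ (klFlowFrameU L M β U μ n) d 1) q w' ≤ Nb p) →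
        (∀ p : ℕ, 3 ≤ p → Nb p / klLevUnitF β M 0 p (d - 1) ≤ Ab * lam ^ (p - 1) * Qb ^ p) →
        (∀ k' : ℕ, 2 ≤ k' → k' ≤ Kb → ∀ p : ℕ, 3 ≤ p → p ≤ D →
          klTowerBornWtAt L M β U μ (klFlowFrameU L M β U μ n) d (k' - 1) j (2 * p) / klLevUnitF β M 0 p (d * (k' - 1)) ≤ A * lam ^ (p - 1) * Q' ^ p) →
      ∀ p : ℕ, 4 ≤ p → p ≤ D → ∀ (q : Fin (2 * p)) (w : SpaceTimeIdx L M × SectorLeg (sectorCount j)),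
        klWtPinnedSumAt L M β μ (klFlowFrameU L M β U μ n) j j (2 * p) (klTowerInput L M β U μ (klFlowFrameU L M β U μ n) d Kb) q w /
            klLevUnitF β M 0 p j ≤
          (C₁ / C₂) * (Ab + A) * lam ^ (p - 1) * (C₂ ^ 2 * max Q' Qb) ^ p) := by
  obtain ⟨C₁, C₂, hC₁, hC₂, h⟩ := klWtPinnedSumAt_klTowerInput_readout_le_klEng_uniform R c'' hc''
  refine ⟨C₁, C₂, hC₁, hC₂, fun hR2 => ?_⟩
  obtain ⟨c₃, hc₃, U₀, hU₀, h'⟩ := h hR2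
  refine ⟨c₃, hc₃, U₀, hU₀, ?_⟩
  intro G P Q cc hcc hcc6 hcc₃' μ hμ U hU hUle hU₀' hcU β hβmin hβc L M _ _ hL3 hM3 n hn1 hnN hkl hhist hosc d Kb j hd hKb1 hKbj hjn D
    A lam Q' Ab Qb hA hlam hQ hAb hQb Nb hNb0 hcar hlawb hIH p hp hpD q w
  have hβ : 0 < β := KLRegimeSplit.pos_of_klBetaMin_le hβmin
  set K : TrigPolyC4v := klFlowFrameU L M β U μ n with hK
  have hu : 0 < klLevUnitF β M 0 p j := klLevUnitF_pos hβ 0 p _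
  have hdj : d ≤ j := le_trans (Nat.le_mul_of_pos_right d hKb1) hKbj
  -- the m-uniform row at degree `2p = (2p−1)+1`
  have hcar' : ∀ (q : Fin (2 * p - 1 + 1)) (w' : SpaceTimeIdx L M × SectorLeg (sectorCount (d - 1))),
      klWtPinnedSumAt L M β μ K (d - 1) j (2 * p - 1 + 1) (klTowerInput L M β U μ K d 1) q w' ≤ Nb p := by
    rw [show 2 * p - 1 + 1 = 2 * p by omega]; exact hcar p
  have hq' : ∀ (q' : Fin (2 * p - 1 + 1)) (w₀ : SpaceTimeIdx L M × SectorLeg (sectorCount j)),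
      klWtPinnedSumAt L M β μ K j j (2 * p - 1 + 1) (klTowerInput L M β U μ K d Kb) q' w₀ ≤
        C₁ * C₂ ^ (2 * p - 1) * ((2 : ℝ) ^ (j - (d - 1))) ^ (2 * p - 1 - 1) * Nb p +
          ∑ k' ∈ Ico 1 Kb, C₁ * C₂ ^ (2 * p - 1) * ((2 : ℝ) ^ (j - d * k')) ^ (2 * p - 1 - 1) * klTowerBornWtAt L M β U μ K d k' j (2 * p - 1 + 1) :=
    h' (2 * p - 1) G P Q cc hcc hcc6 hcc₃' μ hμ U hU hUle hU₀' hcU β hβmin hβc L M hL3 hM3 n hn1 hnN hkl hhist hosc d Kb j hd hKb1 hKbj hjn (Nb p) (hNb0 p) hcar'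
  have hrow : klWtPinnedSumAt L M β μ K j j (2 * p) (klTowerInput L M β U μ K d Kb) q w ≤
      C₁ * C₂ ^ (2 * p - 1) * ((2 : ℝ) ^ (j - (d - 1))) ^ (2 * p - 2) * Nb p +
        ∑ k' ∈ Ico 1 Kb, C₁ * C₂ ^ (2 * p - 1) * ((2 : ℝ) ^ (j - d * k')) ^ (2 * p - 2) * klTowerBornWtAt L M β U μ K d k' j (2 * p) := by
    have e1 : 2 * p - 1 + 1 = 2 * p := by omega
    have e2 : 2 * p - 1 - 1 = 2 * p - 2 := by omega
    have h1 := hq'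
    rw [e1, e2] at h1
    exact h1 q w
  -- divide by the public floor unit; every jump is a pure gain
  set ρ : ℝ := ((2 : ℝ) ^ d)⁻¹ with hρ
  have hsd1 : (1 : ℝ) < (2 : ℝ) ^ d := one_lt_pow₀ (by norm_num) (by omega)
  have hρ0 : 0 < ρ := by positivity
  have hρ1 : ρ < 1 := inv_lt_one_of_one_lt₀ hsd1
  have hρhalf : ρ ≤ 1 / 2 := by
    rw [hρ, one_div]; exact inv_anti₀ (by norm_num) (by calc (2 : ℝ) = 2 ^ 1 := (pow_one _).symm
      _ ≤ 2 ^ d := pow_le_pow_right₀ (by norm_num) (by omega))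
  set law : ℝ := A * lam ^ (p - 1) * Q' ^ p with hlaw
  have hlaw0 : 0 ≤ law := by positivity
  -- (i) the base term
  have hbase : C₁ * C₂ ^ (2 * p - 1) * ((2 : ℝ) ^ (j - (d - 1))) ^ (2 * p - 2) * Nb p / klLevUnitF β M 0 p j ≤
      C₁ * C₂ ^ (2 * p - 1) * (Ab * lam ^ (p - 1) * Qb ^ p) := by
    have h1 := jumpW_mul_div_klLevUnitF_le (M := M) hβ (J := d - 1) (J' := j) (p := p) (by omega) (by omega) (hNb0 p)
    calc C₁ * C₂ ^ (2 * p - 1) * ((2 : ℝ) ^ (j - (d - 1))) ^ (2 * p - 2) * Nb p / klLevUnitF β M 0 p j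
        = C₁ * C₂ ^ (2 * p - 1) * (((2 : ℝ) ^ (j - (d - 1))) ^ (2 * p - 2) * Nb p / klLevUnitF β M 0 p j) := by ring
      _ ≤ C₁ * C₂ ^ (2 * p - 1) * (Nb p / klLevUnitF β M 0 p (d - 1)) := mul_le_mul_of_nonneg_left h1 (by positivity)
      _ ≤ C₁ * C₂ ^ (2 * p - 1) * (Ab * lam ^ (p - 1) * Qb ^ p) := mul_le_mul_of_nonneg_left (hlawb p (by omega)) (by positivity)
  -- (ii) the born terms: each `≤ C₁C₂^{2p−1}·ρ^{K_b−k′}·law`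
  have hterm : ∀ k' ∈ Ico 1 Kb, C₁ * C₂ ^ (2 * p - 1) * ((2 : ℝ) ^ (j - d * k')) ^ (2 * p - 2) * klTowerBornWtAt L M β U μ K d k' j (2 * p) /
      klLevUnitF β M 0 p j ≤ C₁ * C₂ ^ (2 * p - 1) * (ρ ^ (Kb - k') * law) := by
    intro k' hk'
    obtain ⟨hk'1, hk'k⟩ := mem_Ico.1 hk'
    have hjmp : d * k' + d * (Kb - k') ≤ j := by
      have : d * k' + d * (Kb - k') = d * Kb := by rw [← Nat.mul_add]; congr 1; omega
      omega
    have h1 := jumpW_mul_div_klLevUnitF_le_rate (M := M) hβ (J := d * k') (J' := j) (p := p) (d := d) (n := Kb - k') hjmp hp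
      (klTowerBornWtAt_nonneg (L := L) (M := M) hβ.le U μ K d k' j (2 * p))
    have hb : klTowerBornWtAt L M β U μ K d k' j (2 * p) / klLevUnitF β M 0 p (d * k') ≤ law := by
      have h2 := hIH (k' + 1) (by omega) (by omega) p (by omega) hpD
      simp only [Nat.add_sub_cancel] at h2
      exact h2
    calc C₁ * C₂ ^ (2 * p - 1) * ((2 : ℝ) ^ (j - d * k')) ^ (2 * p - 2) * klTowerBornWtAt L M β U μ K d k' j (2 * p) / klLevUnitF β M 0 p j
        = C₁ * C₂ ^ (2 * p - 1) * (((2 : ℝ) ^ (j - d * k')) ^ (2 * p - 2) * klTowerBornWtAt L M β U μ K d k' j (2 * p) / klLevUnitF β M 0 p j) := by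
          ring
      _ ≤ C₁ * C₂ ^ (2 * p - 1) * (ρ ^ (Kb - k') * (klTowerBornWtAt L M β U μ K d k' j (2 * p) / klLevUnitF β M 0 p (d * k'))) :=
          mul_le_mul_of_nonneg_left h1 (by positivity)
      _ ≤ C₁ * C₂ ^ (2 * p - 1) * (ρ ^ (Kb - k') * law) := mul_le_mul_of_nonneg_left (mul_le_mul_of_nonneg_left hb (by positivity)) (by positivity)
  -- the geometric sum `Σ_{1≤k′<K_b} ρ^{K_b−k′} ≤ ρ/(1−ρ) ≤ 1`
  have hgeom : ∑ k' ∈ Ico 1 Kb, ρ ^ (Kb - k') ≤ 1 := by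
    have hsub : Ico 1 Kb ⊆ range Kb := fun k' hk' => mem_range.2 (mem_Ico.1 hk').2
    have h1 : ∑ k' ∈ Ico 1 Kb, ρ ^ (Kb - k') ≤ ∑ k' ∈ range Kb, ρ ^ (Kb - k') :=
      sum_le_sum_of_subset_of_nonneg hsub fun k' _ _ => by positivity
    have h2 : ∑ k' ∈ range Kb, ρ ^ (Kb - k') = ρ * ∑ i ∈ range Kb, ρ ^ i := by
      rw [← sum_range_reflect (fun i => ρ ^ (Kb - i)) Kb, mul_sum]
      refine sum_congr rfl fun i hi => ?_
      have hi' := mem_range.1 hi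
      rw [show Kb - (Kb - 1 - i) = i + 1 by omega, pow_succ, mul_comm]
    have h3 : ∑ i ∈ range Kb, ρ ^ i ≤ 1 / (1 - ρ) := by
      rw [range_eq_Ico]; simpa using geom_sum_Ico_le_of_lt_one hρ0.le hρ1 (m := 0) (n := Kb)
    have h4 : ρ * (1 / (1 - ρ)) ≤ 1 := by
      rw [mul_one_div, div_le_one (sub_pos.2 hρ1)]; linarith
    calc ∑ k' ∈ Ico 1 Kb, ρ ^ (Kb - k') ≤ ρ * ∑ i ∈ range Kb, ρ ^ i := h1.trans (le_of_eq h2)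
      _ ≤ ρ * (1 / (1 - ρ)) := mul_le_mul_of_nonneg_left h3 hρ0.le
      _ ≤ 1 := h4
  have hsum : (∑ k' ∈ Ico 1 Kb, C₁ * C₂ ^ (2 * p - 1) * ((2 : ℝ) ^ (j - d * k')) ^ (2 * p - 2) * klTowerBornWtAt L M β U μ K d k' j (2 * p)) /
      klLevUnitF β M 0 p j ≤ C₁ * C₂ ^ (2 * p - 1) * law := by
    rw [sum_div]
    refine (sum_le_sum hterm).trans ?_
    rw [← mul_sum, ← sum_mul]
    calc C₁ * C₂ ^ (2 * p - 1) * ((∑ k' ∈ Ico 1 Kb, ρ ^ (Kb - k')) * law)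
        ≤ C₁ * C₂ ^ (2 * p - 1) * (1 * law) := mul_le_mul_of_nonneg_left (mul_le_mul_of_nonneg_right hgeom hlaw0) (by positivity)
      _ = C₁ * C₂ ^ (2 * p - 1) * law := by rw [one_mul]
  -- assemble
  have hC : C₁ * C₂ ^ (2 * p - 1) = C₁ / C₂ * (C₂ ^ 2) ^ p := by
    have hpw : (C₂ ^ 2) ^ p = C₂ ^ (2 * p - 1) * C₂ := by
      rw [← pow_mul, ← pow_succ]; congr 1; omega
    rw [hpw]
    field_simp
  set Mq := max Q' Qb with hMq
  have hQM : Q' ≤ Mq := le_max_left _ _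
  have hQbM : Qb ≤ Mq := le_max_right _ _
  calc klWtPinnedSumAt L M β μ K j j (2 * p) (klTowerInput L M β U μ K d Kb) q w / klLevUnitF β M 0 p j
      ≤ (C₁ * C₂ ^ (2 * p - 1) * ((2 : ℝ) ^ (j - (d - 1))) ^ (2 * p - 2) * Nb p +
          ∑ k' ∈ Ico 1 Kb, C₁ * C₂ ^ (2 * p - 1) * ((2 : ℝ) ^ (j - d * k')) ^ (2 * p - 2) * klTowerBornWtAt L M β U μ K d k' j (2 * p)) /
          klLevUnitF β M 0 p j := div_le_div_of_nonneg_right hrow hu.le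
    _ ≤ C₁ * C₂ ^ (2 * p - 1) * (Ab * lam ^ (p - 1) * Qb ^ p) + C₁ * C₂ ^ (2 * p - 1) * law := by
        rw [add_div]; exact add_le_add hbase hsum
    _ ≤ C₁ * C₂ ^ (2 * p - 1) * (Ab * lam ^ (p - 1) * Mq ^ p) + C₁ * C₂ ^ (2 * p - 1) * (A * lam ^ (p - 1) * Mq ^ p) := by
        refine add_le_add (mul_le_mul_of_nonneg_left ?_ (by positivity)) (mul_le_mul_of_nonneg_left ?_ (by positivity))
        · exact mul_le_mul_of_nonneg_left (pow_le_pow_left₀ hQb hQbM p) (by positivity)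
        · exact mul_le_mul_of_nonneg_left (pow_le_pow_left₀ hQ hQM p) (by positivity)
    _ = (C₁ / C₂) * (Ab + A) * lam ^ (p - 1) * (C₂ ^ 2 * Mq) ^ p := by rw [hC, mul_pow]; ring

end Summit.HubbardSuperconductivity.HubbardSuperconductivity.Theorems.EngineV8

end
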